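import Mathlib
import HarnessLib
import Literature.MathematicalPhysics.StatisticalMechanics.LinearisedMapLargePart
import Literature.MathematicalPhysics.StatisticalMechanics.PolymerNorms
import Literature.MathematicalPhysics.StatisticalMechanics.RenormalisationMap
import Literature.MathematicalPhysics.StatisticalMechanics.RenormalisationStepLocality

/-!
# Lemma 10.2 of [ABKM19] in norm form: `‖F‖_{k+1}^{(A)} ≤ ε(A) ‖K‖_k^{(A)}` for the large-polymer
# part `F(U) = Σ_{X ∈ 𝒫_k^c∖ℬ_k, π(X)=U} R_{k+1}K(X)` of the linearised map `C^{(q)}`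

Assembly of the combinatorial form `tayNormLE_largePart` with the norm predicates of
`PolymerNorms` (`WeakNormLE P k K C` = `‖K‖_k^{(A)} ≤ C`) and the integration map
`R_{k+1} = fluct 𝒞` of `RenormalisationMap`.  The analytic inputs enter as named hypotheses on the
norm parameters `P`:

* `IntegrationProperty P k 𝒞 κ` — Lemma 8.4 / (w7): `‖R_{k+1}F‖_{k:k+1,X} ≤ κ^{|X|_k} ‖F‖_{k,X}`
  for local `C^{r₀}` functionals on connected `k`-polymers (for the [ABKM19] weights this is
  `tayNormLE_integral_abkm`, `κ = A_𝒫`);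
* `NextWeightDominates P k` — (w6): `w_{k:k+1}^X ≤ w_{k+1}^{π(X)}`;
* the scale relations of the gauges (`𝔥_{k+1} ≤ 𝔥_k`, `R_k ≤ R_{k+1}`, `X* ⊆ π(X)*` via the radii
  condition of (6.28)), which give Lemma 8.1 `|·|_{k+1,π(X),T_φ} ≤ |·|_{k,X,T_φ}`.

Result: **`tayNormLE_largePart_fluct`** — `WeakNormLE P k K C` implies, for every non-empty
`(k+1)`-polymer `U`, `|F(U)|_{k+1,U,T_φ} ≤ C ε(A) A^{−|U|_{k+1}} w_{k+1}^U(φ)` with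
`ε(A) = 2^{L^d} κ A^{−(1−1/η)} + L^d c(d) κ² A^{−1}` (`largePartEps`), given the closure gain
`η|X̄|_{k+1} ≤ |X|_k` for large connected `X` ([Bry09] Lemma 6.15).  Everything here is proved.

## References
* S. Adams, S. Buchholz, R. Kotecký, S. Müller, arXiv:1910.13564, Lemma 10.2, Lemma 8.1, Lemma 8.4,
  Theorem 7.1 (w6), (w7) [AdamsBuchholzKoteckyMuller2019].
-/

noncomputable section

namespace Literature.MathematicalPhysics.StatisticalMechanics.GradientRG

open scoped BigOperators Classical
open Finset
open Literature.MathematicalPhysics.StatisticalMechanics.TorusPolymer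
  (IsPolymer blocks numBlocks polys closure reblock thicken card_blocks_eq_numBlocks)
open Literature.Barriers.CriticalPhenomena.LongRangePhi4.Polymer (IsConn)
open Literature.MathematicalPhysics.QuantumFieldTheory

variable {d M : ℕ} [NeZero M]

/-! ## The analytic inputs as hypotheses on the norm parameters -/

/-- **The integration property (Lemma 8.4, `ℓ = 0`; Theorem 7.1 (w7))** at scale `k` for the step
kernel `𝒞` with constant `κ` per block: for every connected `k`-polymer `X` and every `T_k^{X*}`-local
`C^{r₀}` functional `F` with `‖F‖_{k,X} ≤ C`, `‖R_{k+1}F‖_{k:k+1,X} ≤ C κ^{|X|_k}`.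
For the [ABKM19] weights this is `tayNormLE_integral_abkm` (`κ = A_𝒫`).
[cite: AdamsBuchholzKoteckyMuller2019, Lemma 8.4 (8.5)] -/
def IntegrationProperty (P : NormParams d M) (k : ℕ) (𝒞 : (Fin d → ZMod M) → ℝ) (κ : ℝ) : Prop :=
  ∀ X : Finset (Fin d → ZMod M), IsPolymer (P.L ^ k) X → IsConn X →
    ∀ (F : ((Fin d → ZMod M) → ℝ) → ℂ) (C : ℝ), 0 ≤ C → ContDiff ℝ P.r₀ F →
      IsGaugeLocal (P.gauge k X) F → TayNormLE (P.gauge k X) P.r₀ (P.W.weight k X) F C →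
        TayNormLE (P.gauge k X) P.r₀ (P.W.midWeight k X) (fluct 𝒞 F) (C * κ ^ numBlocks (P.L ^ k) X)

/-- **(w6)**: `w_{k:k+1}^X(φ) ≤ w_{k+1}^{π(X)}(φ)` for connected `k`-polymers `X`.
[cite: AdamsBuchholzKoteckyMuller2019, Theorem 7.1 (w6)] -/
def NextWeightDominates (P : NormParams d M) (k : ℕ) : Prop :=
  ∀ X : Finset (Fin d → ZMod M), IsPolymer (P.L ^ k) X → IsConn X →
    ∀ φ, P.W.midWeight k X φ ≤ P.W.weight (k + 1) (reblock (P.L ^ k) (P.L * P.L ^ k) X) φ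

/-! ## Lemma 8.1: the gauge of the next scale on `π(X)` is weaker -/

/-- **Lemma 8.1 / (6.28)**: `‖T_k^{X*} ξ‖ ≤ ‖T_{k+1}^{π(X)*} ξ‖` when `𝔥_{k+1} ≤ 𝔥_k`, `R_k ≤ R_{k+1}`
and the radii satisfy `rad_k ≤ rad_{k+1}`, `rad_k + (2^d − 1)L^k ≤ rad_{k+1}` (so `X* ⊆ π(X)*`).
[cite: AdamsBuchholzKoteckyMuller2019, Lemma 8.1] -/
theorem norm_gauge_le_norm_gauge_succ (P : NormParams d M) {k t : ℕ} (hM : M = P.L ^ k * t)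
    (hL : Odd P.L) (ht : Odd t) (h𝔥 : 0 < P.𝔥 (k + 1)) (h𝔥le : P.𝔥 (k + 1) ≤ P.𝔥 k)
    (hR : 0 < P.R k) (hRle : P.R k ≤ P.R (k + 1)) (hrad : P.rad k ≤ P.rad (k + 1))
    (hrad' : P.rad k + (2 ^ d - 1) * P.L ^ k ≤ P.rad (k + 1)) (X : Finset (Fin d → ZMod M))
    (ξ : (Fin d → ZMod M) → ℝ) :
    ‖P.gauge k X ξ‖ ≤ ‖P.gauge (k + 1) (reblock (P.L ^ k) (P.L * P.L ^ k) X) ξ‖ := by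
  unfold NormParams.gauge
  have hsub : thicken (P.rad k) X ⊆ thicken (P.rad (k + 1)) (reblock (P.L ^ k) (P.L * P.L ^ k) X) :=
    TorusPolymer.thicken_subset_thicken_reblock hM (hL.pow) ht hL hrad hrad' X
  exact (norm_fieldGauge_mono_set _ _ _ hsub ξ).trans
    (norm_fieldGauge_mono_weights h𝔥 h𝔥le hR hRle _ _ ξ)

/-! ## Lemma 10.2 in norm form -/

/-- **Lemma 10.2 (norm form).**  Let `‖K‖_k^{(A)} ≤ C` (`WeakNormLE P k K C`), `K(X, ·)` local and
`C^{r₀}` with `C^{r₀}` fluctuation integrals, the integration property with constant `κ` per block,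
(w6), the scale relations of the gauges, `1 ≤ A`, `0 ≤ κ ≤ A`, `2^{L^d} κ A^{−(1−1/η)} ≤ 1` and
the closure gain `η|X̄|_{k+1} ≤ |X|_k` for large connected `X`.  Then for every non-empty
`(k+1)`-polymer `U`:
`|F(U)|_{k+1,U,T_φ} ≤ C ε(A) A^{−|U|_{k+1}} w_{k+1}^U(φ)`, i.e. `‖F‖_{k+1}^{(A)} ≤ ε(A) ‖K‖_k^{(A)}`.
[cite: AdamsBuchholzKoteckyMuller2019, Lemma 10.2] -/
theorem tayNormLE_largePart_fluct (P : NormParams d M) {k t : ℕ} (hM : M = P.L ^ (k + 1) * t)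
    (hL : Odd P.L) (ht : Odd t) (h𝔥 : 0 < P.𝔥 (k + 1)) (h𝔥le : P.𝔥 (k + 1) ≤ P.𝔥 k)
    (hR : 0 < P.R k) (hRle : P.R k ≤ P.R (k + 1)) (hrad : P.rad k ≤ P.rad (k + 1))
    (hrad' : P.rad k + (2 ^ d - 1) * P.L ^ k ≤ P.rad (k + 1)) (hA : 1 ≤ P.A)
    {𝒞 : (Fin d → ZMod M) → ℝ} {κ η : ℝ} (hκ : 0 ≤ κ) (hκA : κ ≤ P.A) (hη : 0 < η)
    (hsmall : (2 : ℝ) ^ (P.L ^ d) * (κ * P.A ^ (-(1 - η⁻¹) : ℝ)) ≤ 1)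
    (hgain : ∀ X : Finset (Fin d → ZMod M), IsPolymer (P.L ^ k) X → IsConn X →
      2 ^ d < (blocks (P.L ^ k) X).card →
        η * ((blocks (P.L * P.L ^ k) (closure (P.L * P.L ^ k) X)).card : ℝ) ≤ (blocks (P.L ^ k) X).card)
    (hint : IntegrationProperty P k 𝒞 κ) (hw6 : NextWeightDominates P k)
    {K : Finset (Fin d → ZMod M) → ((Fin d → ZMod M) → ℝ) → ℂ} {C : ℝ} (hC : 0 ≤ C)
    (hK : WeakNormLE P k K C) (hKd : ∀ X, ContDiff ℝ P.r₀ (K X))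
    (hKloc : ∀ X, IsPolymer (P.L ^ k) X → IsConn X → IsGaugeLocal (P.gauge k X) (K X))
    (hRd : ∀ X, ContDiff ℝ P.r₀ (fluct 𝒞 (K X)))
    {U : Finset (Fin d → ZMod M)} (hU : IsPolymer (P.L ^ (k + 1)) U) (hUne : U.Nonempty) :
    TayNormLE (P.gauge (k + 1) U) P.r₀ (P.W.weight (k + 1) U) (largePart (P.L ^ k) P.L (fluct 𝒞) K U)
      (C * largePartEps d P.L P.A κ η * P.aFactor (k + 1) U) := by
  have hLs : P.L * P.L ^ k = P.L ^ (k + 1) := (pow_succ' P.L k).symm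
  have hM' : M = P.L * P.L ^ k * t := hM.trans (by rw [hLs])
  have hMk : M = P.L ^ k * (P.L * t) := hM.trans (by rw [pow_succ]; ring)
  have hA0 : 0 < P.A := by linarith
  -- the per-polymer bounds at the target gauge and weight
  have hper : ∀ X ∈ largePartIndex (P.L ^ k) P.L U,
      TayNormLE (P.gauge (k + 1) U) P.r₀ (P.W.weight (k + 1) U) (fluct 𝒞 (K X))
        (C * (κ ^ (blocks (P.L ^ k) X).card * (P.A ^ (blocks (P.L ^ k) X).card)⁻¹)) := by
    intro X hX
    obtain ⟨hP, hc, -, hr⟩ := mem_largePartIndex.1 hX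
    -- Lemma 8.4: `‖R K(X)‖_{k:k+1,X} ≤ C A^{-|X|} κ^{|X|}`
    have h1 := hint X hP hc (K X) (C * P.aFactor k X)
      (mul_nonneg hC (WeakNormLE.aFactor_pos hA0 k X).le) (hKd X) (hKloc X hP hc) (hK X hP hc)
    -- locality of the fluctuation integral for the scale-`k` gauge
    have hloc : IsGaugeLocal (P.gauge k X) (fluct 𝒞 (K X)) :=
      isGaugeLocal_integral (P.gauge k X) (stepMeasure 𝒞) fun ξ => (hKloc X hP hc).comp_add_right _ ξ
    -- Lemma 8.1: pass to the gauge of `U = π(X)` at scale `k+1`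
    have h2 : TayNormLE (P.gauge (k + 1) U) P.r₀ (P.W.midWeight k X) (fluct 𝒞 (K X))
        (C * P.aFactor k X * κ ^ numBlocks (P.L ^ k) X) := by
      refine h1.of_le_gauge (fun ξ => ?_) (hRd X) hloc
      rw [← hr]
      exact norm_gauge_le_norm_gauge_succ P hMk hL (hL.mul ht) h𝔥 h𝔥le hR hRle hrad hrad' X ξ
    -- (w6): pass to the weight `w_{k+1}^U`
    have hc0 : 0 ≤ C * P.aFactor k X * κ ^ numBlocks (P.L ^ k) X :=
      mul_nonneg (mul_nonneg hC (WeakNormLE.aFactor_pos hA0 k X).le) (pow_nonneg hκ _)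
    have h3 : TayNormLE (P.gauge (k + 1) U) P.r₀ (P.W.weight (k + 1) U) (fluct 𝒞 (K X))
        (C * P.aFactor k X * κ ^ numBlocks (P.L ^ k) X) :=
      h2.mono_weight hc0 fun φ => by rw [← hr]; exact hw6 X hP hc φ
    refine h3.mono (le_of_eq ?_) fun φ => (P.W.weight_pos (k + 1) U φ).le
    rw [NormParams.aFactor, ← card_blocks_eq_numBlocks]; ring
  have hmain := tayNormLE_largePart hM' (hL.pow) hL ht (P.gauge (k + 1) U)
    (w := P.W.weight (k + 1) U) (fun φ => (P.W.weight_pos (k + 1) U φ).le) (R := fluct 𝒞) (K := K)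
    hA hκ hκA hη hC hsmall hgain (by rwa [hLs]) hUne (fun X _ => hRd X) hper
  refine hmain.mono (le_of_eq ?_) fun φ => (P.W.weight_pos (k + 1) U φ).le
  rw [NormParams.aFactor, ← card_blocks_eq_numBlocks, hLs]

end Literature.MathematicalPhysics.StatisticalMechanics.GradientRG

end
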